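import Summits.CriticalPhenomena.PercolationContinuityZ3.Theorems.PercNearOneGluingNoHeavyLowerTailSahiCoordinateDisjunctiveGluing
import Mathlib.Order.CompleteLattice.Finset
import Mathlib.Tactic.Linarith
import Mathlib.Tactic.Ring
import HarnessLib

/-!
# `NoHeavyLowerTail` (crux stmt-CriticalPhenomena-4575), master-family line P2: CANALYZING PEELING — Kahn's `C_3` for every triple one member of which is a
# nested canalyzing (unate cascade) event, e.g. a clause `x_{e₁} ∨ ⋯ ∨ x_{e_m}`, the other two members ARBITRARY increasing events

Support file (seat `prim-masterthm-p2`, gen 11; `--supports stmt-CriticalPhenomena-4575`); no definition, no sorry.  Memo SAHI-ROUTE.md §4.34.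

Call an increasing event `D ⊆ 2^ι` a UNIVERSAL FIRST MEMBER (at the product weight `μ_p`) if `E_3(μ_p; 1_D, 1_B, 1_C) ≥ 0` for ALL increasing `B, C`
(spelled out as a hypothesis, no definition).  `∅` and `2^ι` are universal (`E_3 = 0`, resp. `E_3 = Cov(B,C)`: `sahiE_three_univ_left`).
The two one-coordinate inheritance theorems with ARBITRARY co-dependence — master-conj's (A) `Pointwise.sahiE_three_interCoord_nonneg` (a member REQUIRING `e`)
and this seat's `SahiCoordinateGluing.sahiE_three_unionCoord_one_arb_nonneg` (a member IMPLIED by `e`, p279826) — say that universality is preserved by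
AND-ing or OR-ing in coordinates the member does not yet depend on:
* `universal_union_coordEvents`:  `D` universal and free of the coordinates in `S`  ⟹  `D ∪ ⋃_{e∈S} {e ∈ ω}` universal;
* `universal_inter_coordEvents`:  `D` universal and free of the coordinates in `S`  ⟹  `D ∩ ⋂_{e∈S} {e ∈ ω}` universal.
Alternating the two from `D = ∅ / 2^ι` produces every monotone NESTED CANALYZING event `x_{e₁} ⋄₁ (x_{e₂} ⋄₂ (⋯ x_{e_m}))`, `⋄_i ∈ {∧, ∨}` (no definition is
introduced; each alternation is one application).  COROLLARIES (`sahiE_three_nonneg_of_clause_member`, `sahiE_three_nonneg_of_cylinder_member`):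
**Kahn's `C_3` holds, at every product measure, for every triple of increasing events one of which is a clause `⋃_{e∈S}{e∈ω}` or a cylinder `⋂_{e∈S}{e∈ω}`,
the other two ARBITRARY** (the cylinder case is classical — Sahi's principal up-sets / P3's cylinder padding; the clause case with arbitrary partners is new
here: P3's OR-results need the partners to ignore the OR-ed coordinates, Theorem A needs `|supp f ∩ supp g| ≤ 1`).
HONEST FRAMING: corollaries of two inheritance identities; Kahn's Conjecture 5 / Sahi's `C_3` remain OPEN.  Axioms standard. [this work]
-/

noncomputable section

open scoped Classical

namespace Summit.CriticalPhenomena.PercolationContinuityZ3.Theorems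

namespace SahiCoordinateGluing

open Finset Function
open Literature.Combinatorics.Sahi2008
open Literature.Probability.Percolation.DecisionTree (ind ind_of_mem ind_of_not_mem ind_nonneg)
open SahiCombDisjunct

variable {ι : Type} [Fintype ι]

/-! ### 0. Small facts: `E_3` with an empty / full member, slot rotation, sections of coordinate events -/

/-- `E_3(1_{2^ι}, 1_B, 1_C) = Cov(1_B, 1_C)`. [folklore] -/
theorem sahiE_three_univ_left (p : ι → unitInterval) (B C : Set (Set ι)) :
    sahiE (bernoulliWeight p) 3 ![ind (Set.univ : Set (Set ι)), ind B, ind C] =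
      ex (bernoulliWeight p) (ind (B ∩ C)) - ex (bernoulliWeight p) (ind B) * ex (bernoulliWeight p) (ind C) := by
  rw [sahiE_three]
  simp only [ind_mul_ind_eq_inter, Set.univ_inter, ex_ind_univ]
  ring

/-- Slot rotation: `E_3(f, g, h) = E_3(g, h, f)` (a special case of `sahiE_comp_perm`). [cite: Sahi2008, eqs. (4)–(7) (p. 211)] -/
theorem sahiE_three_rotate (μ : Set ι → ℝ) (f g h : Set ι → ℝ) :
    sahiE μ 3 ![f, g, h] = sahiE μ 3 ![g, h, f] := by
  have h1 : g * h * f = f * g * h := by ring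
  have h2 : h * f = f * h := by ring
  have h3 : g * f = f * g := by ring
  rw [sahiE_three, sahiE_three, h1, h2, h3]
  ring

omit [Fintype ι] in
/-- Forcing the coordinate `e` does not change membership of any OTHER coordinate. [folklore] -/
theorem mem_forceAt_of_ne {e e' : ι} (h : e' ≠ e) (b : Bool) (ω : Set ι) : e' ∈ forceAt e b ω ↔ e' ∈ ω := by
  cases b <;> simp [forceAt, h]

omit [Fintype ι] in
/-- A coordinate event is free of every OTHER coordinate. [folklore] -/
theorem secAt_coordEvent_ne {e e' : ι} (h : e' ≠ e) (b : Bool) :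
    secAt e b {ω : Set ι | e' ∈ ω} = {ω : Set ι | e' ∈ ω} := by
  ext ω
  simp only [mem_secAt, Set.mem_setOf_eq, mem_forceAt_of_ne h]

omit [Fintype ι] in
/-- Sections commute with the clause `⋃_{e'∈S} {e' ∈ ω}` over coordinates other than `e`. [folklore] -/
theorem secAt_clause_of_notMem {e : ι} {S : Finset ι} (he : e ∉ S) (b : Bool) :
    secAt e b (⋃ e' ∈ S, {ω : Set ι | e' ∈ ω}) = ⋃ e' ∈ S, {ω : Set ι | e' ∈ ω} := by
  ext ω
  simp only [mem_secAt, Set.mem_iUnion, Set.mem_setOf_eq]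
  constructor
  · rintro ⟨e', he', hm⟩
    exact ⟨e', he', (mem_forceAt_of_ne (fun hh : e' = e => he (hh ▸ he')) b ω).1 hm⟩
  · rintro ⟨e', he', hm⟩
    exact ⟨e', he', (mem_forceAt_of_ne (fun hh : e' = e => he (hh ▸ he')) b ω).2 hm⟩

omit [Fintype ι] in
/-- Sections commute with the cylinder `⋂_{e'∈S} {e' ∈ ω}` over coordinates other than `e`. [folklore] -/
theorem secAt_cylinder_of_notMem {e : ι} {S : Finset ι} (he : e ∉ S) (b : Bool) :
    secAt e b (⋂ e' ∈ S, {ω : Set ι | e' ∈ ω}) = ⋂ e' ∈ S, {ω : Set ι | e' ∈ ω} := by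
  ext ω
  simp only [mem_secAt, Set.mem_iInter, Set.mem_setOf_eq]
  constructor
  · intro hall e' he'
    exact (mem_forceAt_of_ne (fun hh : e' = e => he (hh ▸ he')) b ω).1 (hall e' he')
  · intro hall e' he'
    exact (mem_forceAt_of_ne (fun hh : e' = e => he (hh ▸ he')) b ω).2 (hall e' he')

omit [Fintype ι] in
/-- Clauses are increasing. [folklore] -/
theorem isUpperSet_clause (S : Finset ι) : IsUpperSet (⋃ e' ∈ S, {ω : Set ι | e' ∈ ω}) :=
  isUpperSet_iUnion₂ fun e' _ => Pointwise.isUpperSet_coordEvent e'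

omit [Fintype ι] in
/-- Cylinders are increasing. [folklore] -/
theorem isUpperSet_cylinder (S : Finset ι) : IsUpperSet (⋂ e' ∈ S, {ω : Set ι | e' ∈ ω}) :=
  isUpperSet_iInter₂ fun e' _ => Pointwise.isUpperSet_coordEvent e'

/-! ### 1. OR-peeling: universality survives `D ↦ D ∪ ⋃_{e∈S} {e ∈ ω}` -/

/-- **OR-peeling.**  If the increasing event `D` is free of every coordinate of `S` and is a universal first member (`E_3(D, B, C) ≥ 0` for all
increasing `B, C`), then so is `D ∪ ⋃_{e∈S} {e ∈ ω}`: for ALL increasing `B, C`, `E_3(μ_p; D ∪ ⋃_{e∈S}{e∈ω}, B, C) ≥ 0`. [this work] -/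
theorem universal_union_coordEvents (p : ι → unitInterval) {D : Set (Set ι)} (hD : IsUpperSet D) (S : Finset ι)
    (hDS : ∀ e ∈ S, ∀ b : Bool, secAt e b D = D)
    (hgood : ∀ B C : Set (Set ι), IsUpperSet B → IsUpperSet C →
      0 ≤ sahiE (bernoulliWeight p) 3 (fun j => ind ((![D, B, C] : Fin 3 → Set (Set ι)) j))) :
    ∀ B C : Set (Set ι), IsUpperSet B → IsUpperSet C →
      0 ≤ sahiE (bernoulliWeight p) 3
        (fun j => ind ((![D ∪ ⋃ e ∈ S, {ω : Set ι | e ∈ ω}, B, C] : Fin 3 → Set (Set ι)) j)) := by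
  induction S using Finset.induction_on with
  | empty =>
    intro B C hB hC
    have h0 : D ∪ ⋃ e ∈ (∅ : Finset ι), {ω : Set ι | e ∈ ω} = D := by simp
    rw [h0]
    exact hgood B C hB hC
  | @insert e S' heS' ih =>
    intro B C hB hC
    have hDS' : ∀ e' ∈ S', ∀ b : Bool, secAt e' b D = D := fun e' he' b => hDS e' (Finset.mem_insert_of_mem he') b
    have hDe : ∀ b : Bool, secAt e b D = D := fun b => hDS e (Finset.mem_insert_self e S') b
    -- `D ∪ ⋃_{insert e S'} = (D ∪ ⋃_{S'}) ∪ {e ∈ ω}`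
    have hset : D ∪ ⋃ e' ∈ insert e S', {ω : Set ι | e' ∈ ω} = (D ∪ ⋃ e' ∈ S', {ω : Set ι | e' ∈ ω}) ∪ {ω : Set ι | e ∈ ω} := by
      rw [Finset.set_biUnion_insert]
      ext ω; simp only [Set.mem_union]; tauto
    rw [hset]
    have hA : IsUpperSet (D ∪ ⋃ e' ∈ S', {ω : Set ι | e' ∈ ω}) := hD.union (isUpperSet_clause S')
    have hAe : ∀ b : Bool, secAt e b (D ∪ ⋃ e' ∈ S', {ω : Set ι | e' ∈ ω}) = D ∪ ⋃ e' ∈ S', {ω : Set ι | e' ∈ ω} := by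
      intro b
      rw [secAt_union, hDe b, secAt_clause_of_notMem heS' b]
    exact sahiE_three_unionCoord_one_arb_nonneg p e hA hB hC hAe
      (ih hDS' (secAt e false B) (secAt e false C) (isUpperSet_secAt e false hB) (isUpperSet_secAt e false hC))

/-! ### 2. AND-peeling: universality survives `D ↦ D ∩ ⋂_{e∈S} {e ∈ ω}` (master-conj's identity (A), rotated to the first slot) -/

/-- (A) in the first slot: for increasing `D, B, C` with `D` `e`-free, `E_3(D, B¹, C¹) ≥ 0 ⟹ E_3(D ∩ {e∈ω}, B, C) ≥ 0`. [this work] -/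
theorem sahiE_three_interCoord_first_nonneg (p : ι → unitInterval) (e : ι) {D B C : Set (Set ι)} (hD : IsUpperSet D)
    (hB : IsUpperSet B) (hC : IsUpperSet C) (hDe : ∀ b : Bool, secAt e b D = D)
    (h1 : 0 ≤ sahiE (bernoulliWeight p) 3 (fun j => ind ((![D, secAt e true B, secAt e true C] : Fin 3 → Set (Set ι)) j))) :
    0 ≤ sahiE (bernoulliWeight p) 3 (fun j => ind ((![D ∩ {ω : Set ι | e ∈ ω}, B, C] : Fin 3 → Set (Set ι)) j)) := by
  have h1' : 0 ≤ sahiE (bernoulliWeight p) 3 (fun j => ind ((![secAt e true B, secAt e true C, D] : Fin 3 → Set (Set ι)) j)) := by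
    rw [Pointwise.ind_vec3] at h1 ⊢
    rw [← sahiE_three_rotate]
    exact h1
  have h := Pointwise.sahiE_three_interCoord_nonneg p e hB hC hD hDe h1'
  rw [Pointwise.ind_vec3] at h ⊢
  rw [sahiE_three_rotate]
  exact h

/-- **AND-peeling.**  If the increasing event `D` is free of every coordinate of `S` and is a universal first member, then so is
`D ∩ ⋂_{e∈S} {e ∈ ω}`. [this work] -/
theorem universal_inter_coordEvents (p : ι → unitInterval) {D : Set (Set ι)} (hD : IsUpperSet D) (S : Finset ι)
    (hDS : ∀ e ∈ S, ∀ b : Bool, secAt e b D = D)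
    (hgood : ∀ B C : Set (Set ι), IsUpperSet B → IsUpperSet C →
      0 ≤ sahiE (bernoulliWeight p) 3 (fun j => ind ((![D, B, C] : Fin 3 → Set (Set ι)) j))) :
    ∀ B C : Set (Set ι), IsUpperSet B → IsUpperSet C →
      0 ≤ sahiE (bernoulliWeight p) 3
        (fun j => ind ((![D ∩ ⋂ e ∈ S, {ω : Set ι | e ∈ ω}, B, C] : Fin 3 → Set (Set ι)) j)) := by
  induction S using Finset.induction_on with
  | empty =>
    intro B C hB hC
    have h0 : D ∩ ⋂ e ∈ (∅ : Finset ι), {ω : Set ι | e ∈ ω} = D := by simp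
    rw [h0]
    exact hgood B C hB hC
  | @insert e S' heS' ih =>
    intro B C hB hC
    have hDS' : ∀ e' ∈ S', ∀ b : Bool, secAt e' b D = D := fun e' he' b => hDS e' (Finset.mem_insert_of_mem he') b
    have hDe : ∀ b : Bool, secAt e b D = D := fun b => hDS e (Finset.mem_insert_self e S') b
    have hset : D ∩ ⋂ e' ∈ insert e S', {ω : Set ι | e' ∈ ω} = (D ∩ ⋂ e' ∈ S', {ω : Set ι | e' ∈ ω}) ∩ {ω : Set ι | e ∈ ω} := by
      rw [Finset.set_biInter_insert]
      ext ω; simp only [Set.mem_inter_iff]; tauto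
    rw [hset]
    have hA : IsUpperSet (D ∩ ⋂ e' ∈ S', {ω : Set ι | e' ∈ ω}) := hD.inter (isUpperSet_cylinder S')
    have hAe : ∀ b : Bool, secAt e b (D ∩ ⋂ e' ∈ S', {ω : Set ι | e' ∈ ω}) = D ∩ ⋂ e' ∈ S', {ω : Set ι | e' ∈ ω} := by
      intro b
      rw [secAt_inter, hDe b, secAt_cylinder_of_notMem heS' b]
    exact sahiE_three_interCoord_first_nonneg p e hA hB hC hAe
      (ih hDS' (secAt e true B) (secAt e true C) (isUpperSet_secAt e true hB) (isUpperSet_secAt e true hC))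

/-! ### 3. Corollaries: a clause member, a cylinder member -/

/-- **Kahn's `C_3` with a CLAUSE member, the other two members arbitrary**: for every product weight, every finite `S ⊆ ι` and all increasing
events `B, C`, `E_3(μ_p; ⋃_{e∈S}{e∈ω}, B, C) ≥ 0`. [this work] -/
theorem sahiE_three_nonneg_of_clause_member (p : ι → unitInterval) (S : Finset ι) {B C : Set (Set ι)} (hB : IsUpperSet B)
    (hC : IsUpperSet C) :
    0 ≤ sahiE (bernoulliWeight p) 3 (fun j => ind ((![⋃ e ∈ S, {ω : Set ι | e ∈ ω}, B, C] : Fin 3 → Set (Set ι)) j)) := by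
  -- `∅` is free of every coordinate and `E_3(1_∅, ·, ·) = 0` (cf. `SahiCombMix.secAt_empty'`, `SahiJuntaSlotThree.sahiE_three_empty`; inlined to keep imports light)
  have hsec : ∀ e ∈ S, ∀ b : Bool, secAt e b (∅ : Set (Set ι)) = ∅ := fun e _ b => by ext ω; simp [mem_secAt]
  have hzero : ∀ B' C' : Set (Set ι), sahiE (bernoulliWeight p) 3 ![ind (∅ : Set (Set ι)), ind B', ind C'] = 0 := fun B' C' => by
    rw [sahiE_three]
    simp only [ind_mul_ind_eq_inter, Set.empty_inter, ex_ind_empty]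
    ring
  have h := universal_union_coordEvents p (D := (∅ : Set (Set ι))) isUpperSet_empty S hsec
    (fun B' C' _ _ => by rw [Pointwise.ind_vec3, hzero]) B C hB hC
  rw [Set.empty_union] at h
  exact h

/-- **`C_3` with a CYLINDER member, the other two members arbitrary** (classical; here as the AND-peeling of `2^ι`). [this work] -/
theorem sahiE_three_nonneg_of_cylinder_member (p : ι → unitInterval) (S : Finset ι) {B C : Set (Set ι)} (hB : IsUpperSet B)
    (hC : IsUpperSet C) :
    0 ≤ sahiE (bernoulliWeight p) 3 (fun j => ind ((![⋂ e ∈ S, {ω : Set ι | e ∈ ω}, B, C] : Fin 3 → Set (Set ι)) j)) := by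
  -- `2^ι` is free of every coordinate (cf. `SahiCombMix.secAt_univ'`; inlined to keep imports light)
  have hsec : ∀ e ∈ S, ∀ b : Bool, secAt e b (Set.univ : Set (Set ι)) = Set.univ := fun e _ b => by ext ω; simp [mem_secAt]
  have h := universal_inter_coordEvents p (D := (Set.univ : Set (Set ι))) isUpperSet_univ S hsec
    (fun B' C' hB' hC' => by
      rw [Pointwise.ind_vec3, sahiE_three_univ_left]
      exact Pointwise.cov_ind_nonneg p hB' hC') B C hB hC
  rw [Set.univ_inter] at h
  exact h

end SahiCoordinateGluing

end Summit.CriticalPhenomena.PercolationContinuityZ3.Theorems
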